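import Summits.NavierStokesRegularity.NavierStokesRegularity.Theorems.ExtremiserTransienceDissipationLedgerTypeIWindowPackage
import Literature.Analysis.FunctionSpaces.PoincareWirtingerConvex
import HarnessLib

/-!
# Route `ExtremiserTransience`, crux `NearExtremalTransiencePerFlow` (stmt-NavierStokesRegularity-26567),
# LINE g10-α «dissipation ledger» (and LINE g10-β «tight-or-chain»), stub L2 `stub_violatorDissipation`: A LEVEL POINT SPENDS DISSIPATION

`--supports stmt-NavierStokesRegularity-26567` (registered stub L2 of the skeleton of record
`Cruxes/NearExtremalTransiencePerFlow/Lines/dissipation_ledger.lean`; the same stub, character for character, of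
`Cruxes/NearExtremalTransiencePerFlow/Lines/tight_or_chain.lean`; text of record `ViolatorDissipation` in
`Theorems/ExtremiserTransienceDissipationLedgerDefs.lean`, p703408).  Prover seat `ns-net-p1` (g11).

THE STATEMENT (`ViolatorDissipation`).  For all `K, A` and `ε > 0` there are `c, D > 0` and `0 < a < 1` such that for every Type-I
ancient mild field `W` (constant `K`) with all-time linear local-energy growth `A` (`∫_{B(x,R)} ‖W τ‖² ≤ A R`), every level point
`√(−τ)‖W τ x‖ > ε` forces `dissMeasure W ([(1+a)τ, τ] × B(x, D√(−τ))) ≥ c√(−τ)`.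

PROOF (`L = √(−τ)`; every constant explicit and uniform in `W`).
1. PERSISTENCE (`persistence`): by the uniform package of part 1 (`exists_scaled_package`: `K₁/(−τ)`-Lipschitz in space,
   `L₀/((−τ)L)`-Lipschitz in time on `[2τ, τ]`), with `a ≤ ε/(4(L₀+1))` and `r₁ = ε/(4(K₁+1))` the field keeps
   `‖W t y‖ ≥ ε/(2L)` for `t ∈ [(1+a)τ, τ]`, `y ∈ B(x, r₁L)`.
2. SMALL MEAN (`norm_setAverage_le`, `mean_small`): Young's inequality `‖G‖ ≤ (θ‖G‖² + θ⁻¹)/2` with `θ = 4L/ε` and the growth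
   budget `∫_{B(x,DL)}‖W t‖² ≤ A⁺DL` give `‖⨍_{B(x,DL)} W t‖ ≤ ε/(4L)` once `16A⁺ ≤ V₁ε²D²` (`V₁ = |B₁|`).
3. POINCARÉ–WIRTINGER on the convex ball (`slice_lower`, tree `Literature.Analysis.FunctionSpaces.lintegral_enorm_sub_setAverage_sq_le`,
   constant `2³(2DL)²`): `(ε/(4L))²|B(x,r₁L)| ≤ 32D²L² ∫_{B(x,DL)}‖D(W t)‖²`, i.e. `∫_{B(x,DL)}‖D(W t)‖² ≥ c₁/L` with
   `c₁ = ε²r₁³V₁/(512D²)` (`slice_bound`).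
4. TONELLI over the window of length `a(−τ) = aL²` (`dissMeasure_prod_ge`; measurability from `continuousOn_fderiv_slice`):
   `dissMeasure ≥ c₁aL`, so `c = c₁a`, `D = 4√(A⁺/V₁)/ε + r₁ + 1`, `a = min(½, ε/(4(L₀+1)))`.
Nothing about Navier–Stokes regularity or blow-up is proved; no summit is proved by a line; crux 26567 and NS regularity stay OPEN.
[cite: KochNadirashviliSereginSverak2009, Prop. 4.1 (arXiv:0709.3599v1 p. 8); Evans2010, §5.8.1 Thm. 1]
-/

noncomputable section

open scoped Topology ENNReal ContDiff
open MeasureTheory Filter Set Metric Function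
open Literature.Analysis Literature.Analysis.FluidPDE Literature.Analysis.UnboundedOperators

namespace Summit.NavierStokesRegularity.NavierStokesRegularity.Theorems.NearExtremalTransiencePerFlow.DissipationLedger

-- the problem directory repeats the summit name (`NavierStokesRegularity/NavierStokesRegularity`)
set_option linter.dupNamespace false

/-- **Per-slice Poincaré step.**  If a `C¹` field `G` on `ℝ³` has `‖G‖ ≥ 2m` on the ball `B(x, r₀)`, `r₀ ≤ ρ`, and its
average over `B(x, ρ)` has norm `≤ m` (`m ≥ 0`), then `m² |B(x,r₀)| ≤ 32 ρ² ∫_{B(x,ρ)} ‖DG‖²`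
(Poincaré–Wirtinger on the convex ball, `Literature.Analysis.FunctionSpaces.lintegral_enorm_sub_setAverage_sq_le`). [cite: Evans2010, §5.8.1 Thm. 1] -/
theorem slice_lower {G : EuclideanSpace ℝ (Fin 3) → EuclideanSpace ℝ (Fin 3)} (hG : ContDiff ℝ 1 G)
    {x : EuclideanSpace ℝ (Fin 3)} {ρ r₀ m : ℝ} (hr₀ : 0 < r₀) (hr₀ρ : r₀ ≤ ρ) (hm : 0 ≤ m)
    (hbig : ∀ y ∈ ball x r₀, 2 * m ≤ ‖G y‖)
    (hmean : ‖⨍ y in ball x ρ, G y‖ ≤ m) (hGi : IntegrableOn G (ball x ρ)) :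
    ENNReal.ofReal (m ^ 2) * volume (ball x r₀) ≤
      ENNReal.ofReal (32 * ρ ^ 2) * ∫⁻ y in ball x ρ, ‖fderiv ℝ G y‖ₑ ^ 2 := by
  have hρ : 0 < ρ := lt_of_lt_of_le hr₀ hr₀ρ
  have hQ0 : volume (ball x ρ) ≠ 0 := (measure_ball_pos volume x hρ).ne'
  have hQt : volume (ball x ρ) ≠ ⊤ := measure_ball_lt_top.ne
  have hD : ∀ y ∈ ball x ρ, ∀ z ∈ ball x ρ, ‖y - z‖ ≤ 2 * ρ := by
    intro y hy z hz
    rw [mem_ball, dist_eq_norm] at hy hz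
    calc ‖y - z‖ = ‖(y - x) - (z - x)‖ := by abel_nf
      _ ≤ ‖y - x‖ + ‖z - x‖ := norm_sub_le _ _
      _ ≤ 2 * ρ := by linarith
  have hPW := Literature.Analysis.FunctionSpaces.lintegral_enorm_sub_setAverage_sq_le volume hG
    (convex_ball x ρ) measurableSet_ball hQ0 hQt hGi hD
  rw [finrank_euclideanSpace_fin] at hPW
  have hconst : ENNReal.ofReal (2 ^ 3 * (2 * ρ) ^ 2) = ENNReal.ofReal (32 * ρ ^ 2) := by
    congr 1; ring
  rw [hconst] at hPW
  refine le_trans ?_ hPW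
  -- lower bound on the small ball
  calc ENNReal.ofReal (m ^ 2) * volume (ball x r₀)
      = ∫⁻ _ in ball x r₀, ENNReal.ofReal (m ^ 2) := (setLIntegral_const _ _).symm
    _ ≤ ∫⁻ y in ball x r₀, ‖G y - ⨍ z in ball x ρ, G z‖ₑ ^ 2 := by
        refine setLIntegral_mono' measurableSet_ball fun y hy => ?_
        have h1 : m ≤ ‖G y - ⨍ z in ball x ρ, G z‖ := by
          have h2 := norm_sub_norm_le (G y) (⨍ z in ball x ρ, G z)
          linarith [hbig y hy]
        rw [ENNReal.ofReal_pow hm, ← ofReal_norm]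
        exact pow_le_pow_left' (ENNReal.ofReal_le_ofReal h1) 2
    _ ≤ ∫⁻ y in ball x ρ, ‖G y - ⨍ z in ball x ρ, G z‖ₑ ^ 2 :=
        lintegral_mono_set (ball_subset_ball hr₀ρ)

/-- **Mean bound by Young's inequality.**  For `G` integrable on `B(x,ρ)` with `∫_{B(x,ρ)} ‖G‖² ≤ M` and any `θ > 0`:
`‖⨍_{B(x,ρ)} G‖ ≤ θ M/(2|B(x,ρ)|) + 1/(2θ)` (`‖G‖ ≤ (θ‖G‖² + θ⁻¹)/2` pointwise). [folklore] -/
theorem norm_setAverage_le {G : EuclideanSpace ℝ (Fin 3) → EuclideanSpace ℝ (Fin 3)} {x : EuclideanSpace ℝ (Fin 3)}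
    {ρ θ M : ℝ} (hρ : 0 < ρ) (hθ : 0 < θ) (hGi : IntegrableOn G (ball x ρ))
    (hGsq : IntegrableOn (fun y => ‖G y‖ ^ 2) (ball x ρ)) (hM : ∫ y in ball x ρ, ‖G y‖ ^ 2 ≤ M) :
    ‖⨍ y in ball x ρ, G y‖ ≤ θ * M / (2 * volume.real (ball x ρ)) + 1 / (2 * θ) := by
  have hV : 0 < volume.real (ball x ρ) :=
    ENNReal.toReal_pos (measure_ball_pos volume x hρ).ne' measure_ball_lt_top.ne
  rw [setAverage_eq, norm_smul, Real.norm_eq_abs, abs_inv, abs_of_pos hV]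
  have h1 : ‖∫ y in ball x ρ, G y‖ ≤ ∫ y in ball x ρ, ‖G y‖ := norm_integral_le_integral_norm _
  have h2 : ∫ y in ball x ρ, ‖G y‖ ≤ ∫ y in ball x ρ, (θ / 2 * ‖G y‖ ^ 2 + 1 / (2 * θ)) := by
    refine setIntegral_mono_on hGi.norm ?_ measurableSet_ball fun y _ => ?_
    · exact (hGsq.const_mul (θ / 2)).add (integrableOn_const measure_ball_lt_top.ne)
    · have hy : 0 ≤ ‖G y‖ := norm_nonneg _
      have key : 0 ≤ θ / 2 * ‖G y‖ ^ 2 + 1 / (2 * θ) - ‖G y‖ := by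
        have e : θ / 2 * ‖G y‖ ^ 2 + 1 / (2 * θ) - ‖G y‖ = (θ * ‖G y‖ - 1) ^ 2 / (2 * θ) := by
          field_simp; ring
        rw [e]; positivity
      linarith
  have h3 : ∫ y in ball x ρ, (θ / 2 * ‖G y‖ ^ 2 + 1 / (2 * θ)) =
      θ / 2 * (∫ y in ball x ρ, ‖G y‖ ^ 2) + 1 / (2 * θ) * volume.real (ball x ρ) := by
    rw [integral_add (hGsq.const_mul (θ / 2)) (integrableOn_const measure_ball_lt_top.ne), integral_const_mul,
      setIntegral_const, smul_eq_mul, mul_comm (volume.real (ball x ρ))]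
  have h4 : ∫ y in ball x ρ, ‖G y‖ ≤ θ / 2 * M + 1 / (2 * θ) * volume.real (ball x ρ) := by
    rw [h3] at h2
    have : θ / 2 * (∫ y in ball x ρ, ‖G y‖ ^ 2) ≤ θ / 2 * M := mul_le_mul_of_nonneg_left hM (by positivity)
    linarith
  calc (volume.real (ball x ρ))⁻¹ * ‖∫ y in ball x ρ, G y‖
      ≤ (volume.real (ball x ρ))⁻¹ * (θ / 2 * M + 1 / (2 * θ) * volume.real (ball x ρ)) :=
        mul_le_mul_of_nonneg_left (h1.trans h4) (inv_pos.2 hV).le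
    _ = θ * M / (2 * volume.real (ball x ρ)) + 1 / (2 * θ) := by field_simp

/-- **Time integration of a per-slice lower bound (Tonelli).**  If `(t, y) ↦ fderiv ℝ (W t) y` is continuous on the open
slab `(-∞,0) × ℝ³`, `τ₂ < 0`, and every slice `t ∈ [τ₁, τ₂]` has `∫⁻_{B(x,ρ)} ‖DW(t)‖² ≥ c` (`c ≥ 0`), then
`dissMeasure W ([τ₁,τ₂] × B(x,ρ)) ≥ c (τ₂ - τ₁)`. [folklore] -/
theorem dissMeasure_prod_ge {W : ℝ → EuclideanSpace ℝ (Fin 3) → EuclideanSpace ℝ (Fin 3)}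
    (hcont : ContinuousOn (fun p : ℝ × EuclideanSpace ℝ (Fin 3) => fderiv ℝ (W p.1) p.2) (Iio 0 ×ˢ univ))
    {τ₁ τ₂ : ℝ} (hτ₂ : τ₂ < 0) {x : EuclideanSpace ℝ (Fin 3)} {ρ c : ℝ} (hc : 0 ≤ c)
    (hslice : ∀ t ∈ Icc τ₁ τ₂, ENNReal.ofReal c ≤ ∫⁻ y in ball x ρ, ‖fderiv ℝ (W t) y‖ₑ ^ 2) :
    ENNReal.ofReal (c * (τ₂ - τ₁)) ≤ dissMeasure W (Icc τ₁ τ₂ ×ˢ ball x ρ) := by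
  set F : ℝ × EuclideanSpace ℝ (Fin 3) → ℝ≥0∞ := fun p => ‖fderiv ℝ (W p.1) p.2‖ₑ ^ 2 with hF
  have hS : MeasurableSet (Icc τ₁ τ₂ ×ˢ ball x ρ : Set (ℝ × EuclideanSpace ℝ (Fin 3))) :=
    measurableSet_Icc.prod measurableSet_ball
  rw [dissMeasure, withDensity_apply _ hS]
  -- Tonelli on the restricted product measure
  have hsub : Icc τ₁ τ₂ ×ˢ ball x ρ ⊆ Iio (0 : ℝ) ×ˢ (univ : Set (EuclideanSpace ℝ (Fin 3))) :=
    prod_mono (fun t ht => lt_of_le_of_lt ht.2 hτ₂) (subset_univ _)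
  have hFm : AEMeasurable F ((volume : Measure (ℝ × EuclideanSpace ℝ (Fin 3))).restrict (Icc τ₁ τ₂ ×ˢ ball x ρ)) :=
    (((hcont.mono hsub).aemeasurable hS).enorm.pow_const 2)
  have hprod : (volume : Measure (ℝ × EuclideanSpace ℝ (Fin 3))).restrict (Icc τ₁ τ₂ ×ˢ ball x ρ) =
      ((volume : Measure ℝ).restrict (Icc τ₁ τ₂)).prod ((volume : Measure (EuclideanSpace ℝ (Fin 3))).restrict (ball x ρ)) := by
    rw [Measure.prod_restrict]; rfl
  have key : ∫⁻ p in Icc τ₁ τ₂ ×ˢ ball x ρ, F p =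
      ∫⁻ t in Icc τ₁ τ₂, ∫⁻ y in ball x ρ, F (t, y) := by
    rw [hprod] at hFm ⊢
    exact lintegral_prod F hFm
  show ENNReal.ofReal (c * (τ₂ - τ₁)) ≤ ∫⁻ p in Icc τ₁ τ₂ ×ˢ ball x ρ, F p
  rw [key]
  calc ENNReal.ofReal (c * (τ₂ - τ₁)) = ENNReal.ofReal c * volume (Icc τ₁ τ₂) := by
        rw [Real.volume_Icc, ENNReal.ofReal_mul hc]
    _ = ∫⁻ _ in Icc τ₁ τ₂, ENNReal.ofReal c := (setLIntegral_const _ _).symm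
    _ ≤ ∫⁻ t in Icc τ₁ τ₂, ∫⁻ y in ball x ρ, F (t, y) := setLIntegral_mono' measurableSet_Icc fun t ht => hslice t ht

/-- **Persistence of largeness** near a level point: on `[(1+a)τ, τ] × B(x, r₁√(-τ))` the field stays `≥ ε/(2√(-τ))` (spatial increment `≤ K₁r₁/L ≤ ε/(4L)`, temporal increment `≤ L₀a/L ≤ ε/(4L)`). [folklore] -/
theorem persistence {W : ℝ → EuclideanSpace ℝ (Fin 3) → EuclideanSpace ℝ (Fin 3)} {τ t : ℝ}
    {x : EuclideanSpace ℝ (Fin 3)} {K₁ L₀ ε a r₁ : ℝ} (hτ : τ < 0) (hε : 0 < ε)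
    (hK₁ : 0 ≤ K₁) (hL₀ : 0 ≤ L₀) (haε : a ≤ ε / (4 * (L₀ + 1)))
    (hr₁ : r₁ = ε / (4 * (K₁ + 1))) (ht : t ∈ Icc ((1 + a) * τ) τ)
    (hsp : ∀ x z : EuclideanSpace ℝ (Fin 3), ‖W t z - W t x‖ ≤ K₁ / (-τ) * ‖z - x‖)
    (htm : ‖W τ x - W t x‖ ≤ L₀ / (-τ * Real.sqrt (-τ)) * |τ - t|)
    (hlev : ε < Real.sqrt (-τ) * ‖W τ x‖) :
    ∀ y ∈ ball x (r₁ * Real.sqrt (-τ)), 2 * (ε / (4 * Real.sqrt (-τ))) ≤ ‖W t y‖ := by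
  have hnτ : 0 < -τ := neg_pos.2 hτ
  have hτ0 : τ ≠ 0 := hτ.ne
  obtain ⟨L, hLdef⟩ : ∃ L : ℝ, L = Real.sqrt (-τ) := ⟨_, rfl⟩
  have hL : 0 < L := by rw [hLdef]; exact Real.sqrt_pos.2 hnτ
  have hL2 : L ^ 2 = -τ := by rw [hLdef]; exact Real.sq_sqrt hnτ.le
  rw [← hLdef] at htm hlev ⊢
  have hlev' : ε / L < ‖W τ x‖ := by rw [div_lt_iff₀ hL, mul_comm]; exact hlev
  -- time increment
  have htime : ‖W τ x - W t x‖ ≤ ε / (4 * L) := by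
    have hdt : |τ - t| ≤ a * (-τ) := by
      rw [abs_of_nonneg (by linarith [ht.2])]; nlinarith [ht.1]
    have hcoef : 0 ≤ L₀ / (-τ * L) := by positivity
    have h1 : ‖W τ x - W t x‖ ≤ L₀ / (-τ * L) * (a * (-τ)) := htm.trans (mul_le_mul_of_nonneg_left hdt hcoef)
    have h2 : L₀ / (-τ * L) * (a * (-τ)) = L₀ * a / L := by field_simp
    have h3 : L₀ * a ≤ ε / 4 := by
      calc L₀ * a ≤ L₀ * (ε / (4 * (L₀ + 1))) := mul_le_mul_of_nonneg_left haε hL₀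
        _ = ε / 4 * (L₀ / (L₀ + 1)) := by field_simp
        _ ≤ ε / 4 * 1 :=
            mul_le_mul_of_nonneg_left ((div_le_one (by linarith)).2 (by linarith)) (by positivity)
        _ = ε / 4 := mul_one _
    rw [h2] at h1
    calc ‖W τ x - W t x‖ ≤ L₀ * a / L := h1
      _ ≤ ε / 4 / L := div_le_div_of_nonneg_right h3 hL.le
      _ = ε / (4 * L) := by rw [div_div]
  intro y hy
  rw [mem_ball, dist_eq_norm] at hy
  -- space increment
  have hspace : ‖W t y - W t x‖ ≤ ε / (4 * L) := by
    have h := hsp x y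
    have h1 : K₁ / -τ * ‖y - x‖ ≤ K₁ / -τ * (r₁ * L) :=
      mul_le_mul_of_nonneg_left hy.le (div_nonneg hK₁ hnτ.le)
    have h2 : K₁ / -τ * (r₁ * L) = K₁ * r₁ / L := by rw [← hL2]; field_simp
    have h3 : K₁ * r₁ ≤ ε / 4 := by
      calc K₁ * r₁ = ε / 4 * (K₁ / (K₁ + 1)) := by rw [hr₁]; field_simp
        _ ≤ ε / 4 * 1 :=
            mul_le_mul_of_nonneg_left ((div_le_one (by linarith)).2 (by linarith)) (by positivity)
        _ = ε / 4 := mul_one _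
    calc ‖W t y - W t x‖ ≤ K₁ / -τ * (r₁ * L) := h.trans h1
      _ = K₁ * r₁ / L := h2
      _ ≤ ε / 4 / L := div_le_div_of_nonneg_right h3 hL.le
      _ = ε / (4 * L) := by rw [div_div]
  have h1 := norm_sub_norm_le (W τ x) (W t x)
  have h2 := norm_sub_norm_le (W t x) (W t y)
  rw [norm_sub_rev] at hspace
  have h3 : ε / L = 4 * (ε / (4 * L)) := by field_simp
  linarith

/-- **Small mean** over `B(x, D L)` from the linear growth budget, for `D` large (`16 A⁺ ≤ V₁ ε² D²`): `‖⨍_{B(x,DL)} G‖ ≤ ε/(4L)` (Young with `θ = 4L/ε`). [folklore] -/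
theorem mean_small {G : EuclideanSpace ℝ (Fin 3) → EuclideanSpace ℝ (Fin 3)} (hGc : Continuous G)
    {x : EuclideanSpace ℝ (Fin 3)} {Ap ε V₁ D L : ℝ} (hε : 0 < ε)
    (hV₁ : V₁ = volume.real (ball (0 : EuclideanSpace ℝ (Fin 3)) 1)) (hV₁pos : 0 < V₁)
    (hD : 0 < D) (hL : 0 < L) (hD16 : 16 * Ap ≤ V₁ * ε ^ 2 * D ^ 2)
    (hM : ∫ y in ball x (D * L), ‖G y‖ ^ 2 ≤ Ap * (D * L)) :
    ‖⨍ y in ball x (D * L), G y‖ ≤ ε / (4 * L) := by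
  have hDL : 0 < D * L := by positivity
  have hGi : IntegrableOn G (ball x (D * L)) :=
    (hGc.continuousOn.integrableOn_compact (isCompact_closedBall x (D * L))).mono_set ball_subset_closedBall
  have hGsq : IntegrableOn (fun y => ‖G y‖ ^ 2) (ball x (D * L)) :=
    ((hGc.norm.pow 2).continuousOn.integrableOn_compact (isCompact_closedBall x (D * L))).mono_set
      ball_subset_closedBall
  have h := norm_setAverage_le (θ := 4 * L / ε) hDL (by positivity) hGi hGsq hM
  have hvol : volume.real (ball x (D * L)) = (D * L) ^ 3 * V₁ := by
    rw [← Measure.addHaar_real_closedBall_eq_addHaar_real_ball, Measure.addHaar_real_closedBall _ _ hDL.le,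
      finrank_euclideanSpace_fin, hV₁]
  rw [hvol] at h
  have e1 : 4 * L / ε * (Ap * (D * L)) / (2 * ((D * L) ^ 3 * V₁)) + 1 / (2 * (4 * L / ε)) =
      2 * Ap / (ε * V₁ * D ^ 2 * L) + ε / (8 * L) := by
    field_simp
    ring
  rw [e1] at h
  have e2 : 2 * Ap / (ε * V₁ * D ^ 2 * L) ≤ ε / (8 * L) := by
    rw [div_le_div_iff₀ (by positivity) (by positivity)]
    calc 2 * Ap * (8 * L) = (16 * Ap) * L := by ring
      _ ≤ (V₁ * ε ^ 2 * D ^ 2) * L := mul_le_mul_of_nonneg_right hD16 hL.le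
      _ = ε * (ε * V₁ * D ^ 2 * L) := by ring
  calc ‖⨍ y in ball x (D * L), G y‖ ≤ 2 * Ap / (ε * V₁ * D ^ 2 * L) + ε / (8 * L) := h
    _ ≤ ε / (8 * L) + ε / (8 * L) := by linarith
    _ = ε / (4 * L) := by ring

/-- **The per-slice dissipation bound** on the window `[(1+a)τ, τ]`, all constants explicit:
`∫⁻_{B(x, D√(-τ))} ‖D(W t)‖² ≥ c₁/√(-τ)` with `c₁ = ε² r₁³ V₁/(512 D²)` (persistence + small mean + Poincaré–Wirtinger). [cite: Evans2010, §5.8.1 Thm. 1] -/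
theorem slice_bound {K K₁ L₀ A Ap ε V₁ a r₁ D c₁ : ℝ} (hε : 0 < ε) (hK₁ : 0 ≤ K₁) (hL₀ : 0 ≤ L₀)
    (hpack : ∀ (W : ℝ → EuclideanSpace ℝ (Fin 3) → EuclideanSpace ℝ (Fin 3)), IsTypeIAncientMild K W →
        ∀ τ : ℝ, τ < 0 → ∀ t ∈ Icc (2 * τ) τ,
          (∀ x z : EuclideanSpace ℝ (Fin 3), ‖W t z - W t x‖ ≤ K₁ / (-τ) * ‖z - x‖) ∧
          ∀ t' ∈ Icc (2 * τ) τ, ∀ x : EuclideanSpace ℝ (Fin 3),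
            ‖W t' x - W t x‖ ≤ L₀ / (-τ * Real.sqrt (-τ)) * |t' - t|)
    (hV₁ : V₁ = volume.real (ball (0 : EuclideanSpace ℝ (Fin 3)) 1)) (hV₁pos : 0 < V₁)
    (hAAp : A ≤ Ap) (ha1 : a ≤ 1 / 2) (haε : a ≤ ε / (4 * (L₀ + 1)))
    (hr₁ : r₁ = ε / (4 * (K₁ + 1))) (hr₁pos : 0 < r₁) (hDr : r₁ ≤ D) (hD : 0 < D)
    (hD16 : 16 * Ap ≤ V₁ * ε ^ 2 * D ^ 2) (hc₁ : c₁ = ε ^ 2 * r₁ ^ 3 * V₁ / (512 * D ^ 2))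
    {W : ℝ → EuclideanSpace ℝ (Fin 3) → EuclideanSpace ℝ (Fin 3)} (hW : IsTypeIAncientMild K W)
    (hgr : HasLinGrowthAllTime A W) {τ : ℝ} (hτ : τ < 0) {x : EuclideanSpace ℝ (Fin 3)}
    (hlev : ε < Real.sqrt (-τ) * ‖W τ x‖) {t : ℝ} (ht : t ∈ Icc ((1 + a) * τ) τ) :
    ENNReal.ofReal (c₁ / Real.sqrt (-τ)) ≤
      ∫⁻ y in ball x (D * Real.sqrt (-τ)), ‖fderiv ℝ (W t) y‖ₑ ^ 2 := by
  have hnτ : 0 < -τ := neg_pos.2 hτ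
  obtain ⟨L, hLdef⟩ : ∃ L : ℝ, L = Real.sqrt (-τ) := ⟨_, rfl⟩
  have hL : 0 < L := by rw [hLdef]; exact Real.sqrt_pos.2 hnτ
  rw [← hLdef]
  have ht2 : t ∈ Icc (2 * τ) τ := ⟨by nlinarith [ht.1, ha1, hτ.le], ht.2⟩
  have hτ2 : τ ∈ Icc (2 * τ) τ := ⟨by linarith, le_rfl⟩
  have ht0 : t < 0 := lt_of_le_of_lt ht.2 hτ
  obtain ⟨hsp, htm⟩ := hpack W hW τ hτ t ht2
  -- persistence on the small ball
  have hbig : ∀ y ∈ ball x (r₁ * L), 2 * (ε / (4 * L)) ≤ ‖W t y‖ := by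
    rw [hLdef]
    exact persistence hτ hε hK₁ hL₀ haε hr₁ ht hsp (htm τ hτ2 x) hlev
  -- small mean on the big ball
  have hGc : Continuous (W t) := hW.continuous_slice ht0
  have hDL : 0 < D * L := by positivity
  have hM : ∫ y in ball x (D * L), ‖W t y‖ ^ 2 ≤ Ap * (D * L) :=
    (hgr t ht0 x (D * L) hDL).trans (mul_le_mul_of_nonneg_right hAAp hDL.le)
  have hmean : ‖⨍ y in ball x (D * L), W t y‖ ≤ ε / (4 * L) := mean_small hGc hε hV₁ hV₁pos hD hL hD16 hM
  -- Poincaré–Wirtinger on the big ball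
  have hGi : IntegrableOn (W t) (ball x (D * L)) :=
    (hGc.continuousOn.integrableOn_compact (isCompact_closedBall x (D * L))).mono_set ball_subset_closedBall
  have hP := slice_lower ((hW.contDiff_slice ht0).of_le (by exact_mod_cast le_top)) (x := x)
    (ρ := D * L) (r₀ := r₁ * L) (m := ε / (4 * L)) (by positivity)
    (mul_le_mul_of_nonneg_right hDr hL.le) (by positivity) hbig hmean hGi
  have hvolE : volume (ball x (r₁ * L)) = ENNReal.ofReal ((r₁ * L) ^ 3 * V₁) := by
    rw [Measure.addHaar_ball_of_pos _ _ (by positivity), finrank_euclideanSpace_fin, hV₁, measureReal_def,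
      ENNReal.ofReal_mul (by positivity), ENNReal.ofReal_toReal measure_ball_lt_top.ne]
  rw [hvolE, ← ENNReal.ofReal_mul (by positivity)] at hP
  have hid : 32 * (D * L) ^ 2 * (c₁ / L) = (ε / (4 * L)) ^ 2 * ((r₁ * L) ^ 3 * V₁) := by
    rw [hc₁]; field_simp; ring
  have h32 : ENNReal.ofReal (32 * (D * L) ^ 2) ≠ 0 := (ENNReal.ofReal_pos.2 (by positivity)).ne'
  rw [← ENNReal.mul_le_mul_iff_right h32 ENNReal.ofReal_ne_top, ← ENNReal.ofReal_mul (by positivity), hid]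
  exact hP

/-- **L2 `stub_violatorDissipation` — A LEVEL POINT SPENDS DISSIPATION** (the registered stub L2 of LINE g10-α / g10-β, signature
`ViolatorDissipation` verbatim the text of record): persistence + small mean + Poincaré–Wirtinger per slice (`slice_bound`),
integrated over the window `[(1+a)τ, τ]` by Tonelli (`dissMeasure_prod_ge`); `c = c₁ a`, `D = 4√(A⁺/V₁)/ε + r₁ + 1`,
`a = min(½, ε/(4(L₀+1)))`, all uniform in `W`. [cite: KochNadirashviliSereginSverak2009, Prop. 4.1 (arXiv:0709.3599v1 p. 8)] -/
theorem stub_violatorDissipation : ViolatorDissipation := by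
  intro K A ε hε
  obtain ⟨K₁, L₀, hK₁, hL₀, hpack⟩ := exists_scaled_package K
  -- universal and derived constants
  obtain ⟨V₁, hV₁⟩ : ∃ V₁ : ℝ, V₁ = volume.real (ball (0 : EuclideanSpace ℝ (Fin 3)) 1) := ⟨_, rfl⟩
  have hV₁pos : 0 < V₁ := by
    rw [hV₁]
    exact ENNReal.toReal_pos (measure_ball_pos volume (0 : EuclideanSpace ℝ (Fin 3)) one_pos).ne'
      measure_ball_lt_top.ne
  obtain ⟨Ap, hApdef⟩ : ∃ Ap : ℝ, Ap = max A 0 := ⟨_, rfl⟩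
  have hAp : 0 ≤ Ap := by rw [hApdef]; exact le_max_right _ _
  have hAAp : A ≤ Ap := by rw [hApdef]; exact le_max_left _ _
  obtain ⟨a, hadef⟩ : ∃ a : ℝ, a = min (1 / 2) (ε / (4 * (L₀ + 1))) := ⟨_, rfl⟩
  have ha0 : 0 < a := by rw [hadef]; exact lt_min (by norm_num) (by positivity)
  have ha2 : a ≤ 1 / 2 := by rw [hadef]; exact min_le_left _ _
  have ha1 : a < 1 := by linarith
  have haε : a ≤ ε / (4 * (L₀ + 1)) := by rw [hadef]; exact min_le_right _ _
  obtain ⟨r₁, hr₁⟩ : ∃ r₁ : ℝ, r₁ = ε / (4 * (K₁ + 1)) := ⟨_, rfl⟩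
  have hr₁pos : 0 < r₁ := by rw [hr₁]; positivity
  obtain ⟨D, hDdef⟩ : ∃ D : ℝ, D = 4 * Real.sqrt (Ap / V₁) / ε + r₁ + 1 := ⟨_, rfl⟩
  have hsq0 : 0 ≤ 4 * Real.sqrt (Ap / V₁) / ε := by positivity
  have hD : 0 < D := by rw [hDdef]; linarith
  have hDr : r₁ ≤ D := by rw [hDdef]; linarith
  have hD16 : 16 * Ap ≤ V₁ * ε ^ 2 * D ^ 2 := by
    have h1 : 4 * Real.sqrt (Ap / V₁) / ε ≤ D := by rw [hDdef]; linarith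
    have h2 : (4 * Real.sqrt (Ap / V₁) / ε) ^ 2 ≤ D ^ 2 := pow_le_pow_left₀ hsq0 h1 2
    have h3 : (4 * Real.sqrt (Ap / V₁) / ε) ^ 2 = 16 * Ap / (V₁ * ε ^ 2) := by
      rw [div_pow, mul_pow, Real.sq_sqrt (div_nonneg hAp hV₁pos.le)]
      field_simp
      ring
    rw [h3, div_le_iff₀ (by positivity)] at h2
    linarith
  obtain ⟨c₁, hc₁⟩ : ∃ c₁ : ℝ, c₁ = ε ^ 2 * r₁ ^ 3 * V₁ / (512 * D ^ 2) := ⟨_, rfl⟩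
  have hc₁pos : 0 < c₁ := by rw [hc₁]; positivity
  refine ⟨c₁ * a, D, a, by positivity, hD, ha0, ha1, fun W hW hgr τ x hτ hlev => ?_⟩
  have hnτ : 0 < -τ := neg_pos.2 hτ
  have hL : 0 < Real.sqrt (-τ) := Real.sqrt_pos.2 hnτ
  have hL2 : Real.sqrt (-τ) ^ 2 = -τ := Real.sq_sqrt hnτ.le
  -- per-slice bound on the window, then integrate in time (window length `a(-τ)`)
  have hslice : ∀ t ∈ Icc ((1 + a) * τ) τ, ENNReal.ofReal (c₁ / Real.sqrt (-τ)) ≤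
      ∫⁻ y in ball x (D * Real.sqrt (-τ)), ‖fderiv ℝ (W t) y‖ₑ ^ 2 := fun t ht =>
    slice_bound hε hK₁ hL₀ hpack hV₁ hV₁pos hAAp ha2 haε hr₁ hr₁pos hDr hD hD16 hc₁ hW hgr hτ hlev ht
  have hI := dissMeasure_prod_ge (continuousOn_fderiv_slice hW) (τ₁ := (1 + a) * τ) (τ₂ := τ) hτ (x := x)
    (ρ := D * Real.sqrt (-τ)) (c := c₁ / Real.sqrt (-τ)) (by positivity) hslice
  have hid2 : c₁ / Real.sqrt (-τ) * (τ - (1 + a) * τ) = c₁ * a * Real.sqrt (-τ) := by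
    have e : τ - (1 + a) * τ = a * Real.sqrt (-τ) ^ 2 := by rw [hL2]; ring
    rw [e]
    field_simp
  rw [hid2] at hI
  exact hI

end Summit.NavierStokesRegularity.NavierStokesRegularity.Theorems.NearExtremalTransiencePerFlow.DissipationLedger

end
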